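import Mathlib
import Literature.NumberTheory.EllipticCurves.CuspFormsGamma1EisensteinDivision
import Literature.NumberTheory.Automorphic.UnboundedDenominatorsReductions

/-!
# The integral unitriangular basis `E₄^α E₆^β Δ^i` of level-one modular forms

Stub `stub_levelOneIntegralBasis` for the crux `HilbertIntegralOverconvergentIsCongruence`
(line Sketch-ideate-r1-k1): for `b` even and `i` with `12 i ≤ b`, `b - 12 i ≠ 2`, write
`b - 12 i = 4 α + 6 β` and form the level-one modular form `F = E₄^α · E₆^β · Δ^i` of weight `b`
(Mathlib `ModularForm.mul/pow/mcast`). Its `q`-expansion (period `1`) is the product of the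
`q`-expansions (`ModularForm.qExpansion_mul/_pow`), it is the image of the integer power series
`P = P₄^α P₆^β (X U)^i` (tree: `exists_int_map_eq_qExpansion_E₄/E₆`,
`exists_discriminant_qExpansion_natCast_eq_X_pow_mul`), and `P = Xⁱ · (unit with constant term 1)`
is unitriangular: `coeff n P = 0` for `n < i` and `coeff i P = 1`.
-/

set_option linter.dupNamespace false

noncomputable section

open scoped MatrixGroups

namespace Summit.Langlands.Langlands.Theorems.HilbertIntegralOverconvergentIsCongruence

open Literature.NumberTheory.EllipticCurves.ModularForms
  (exists_int_map_eq_qExpansion_E₄ exists_int_map_eq_qExpansion_E₆)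
open Literature.NumberTheory.Automorphic (exists_discriminant_qExpansion_natCast_eq_X_pow_mul)

/-- **The integral unitriangular basis of `M_b(SL₂(ℤ))`.** For `b` even and `i` with `12 i ≤ b`,
`b - 12 i ≠ 2`, there are `α, β` with `4α + 6β + 12 i = b` and a level-one modular form `F` of
weight `b` whose `q`-expansion is `E₄^α · E₆^β · Δ^i`, which is the image of an integer power
series `P` with `coeff n P = 0` for `n < i` and `coeff i P = 1` (`Δ = q + …`, `E₄, E₆ = 1 + …`).
[folklore] -/
theorem stub_levelOneIntegralBasis (b i : ℕ) (hb : Even b) (hi : 12 * i ≤ b) (h2 : b - 12 * i ≠ 2) :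
    ∃ (α β : ℕ) (F : ModularForm 𝒮ℒ (b : ℤ)) (P : PowerSeries ℤ),
      4 * α + 6 * β + 12 * i = b ∧
      UpperHalfPlane.qExpansion 1 ⇑F =
        UpperHalfPlane.qExpansion 1 ⇑ModularForm.E₄ ^ α * UpperHalfPlane.qExpansion 1 ⇑ModularForm.E₆ ^ β *
          UpperHalfPlane.qExpansion 1 ⇑CuspForm.discriminant ^ i ∧
      UpperHalfPlane.qExpansion 1 ⇑F = P.map (Int.castRingHom ℂ) ∧
      (∀ n < i, PowerSeries.coeff n P = 0) ∧ PowerSeries.coeff i P = 1 := by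
  -- write `b - 12 i = 4 α + 6 β`
  obtain ⟨α, β, hαβ⟩ : ∃ α β : ℕ, 4 * α + 6 * β + 12 * i = b := by
    obtain ⟨m, hm⟩ := hb
    rcases Nat.even_or_odd (m - 6 * i) with ⟨j, hj⟩ | ⟨j, hj⟩
    · exact ⟨j, 0, by omega⟩
    · exact ⟨j - 1, 1, by omega⟩
  -- the integral `q`-expansions of `E₄`, `E₆`, `Δ`
  obtain ⟨P₄, hP₄1, hP₄⟩ := exists_int_map_eq_qExpansion_E₄
  obtain ⟨P₆, hP₆1, hP₆⟩ := exists_int_map_eq_qExpansion_E₆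
  obtain ⟨U, hU1, hU⟩ := exists_discriminant_qExpansion_natCast_eq_X_pow_mul (h := 1) one_pos
  rw [Nat.cast_one, pow_one] at hU
  -- the form `F = E₄^α E₆^β Δ^i`
  let D : ModularForm 𝒮ℒ 12 := (CuspForm.discriminant : ModularForm 𝒮ℒ 12)
  have hD : (⇑D : UpperHalfPlane → ℂ) = ⇑CuspForm.discriminant := rfl
  let F : ModularForm 𝒮ℒ (b : ℤ) :=
    ModularForm.mcast (by rw [← hαβ]; push_cast; ring)
      (((ModularForm.E₄.pow α).mul (ModularForm.E₆.pow β)).mul (D.pow i))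
  have hF : UpperHalfPlane.qExpansion 1 ⇑F =
      UpperHalfPlane.qExpansion 1 ⇑ModularForm.E₄ ^ α *
        UpperHalfPlane.qExpansion 1 ⇑ModularForm.E₆ ^ β *
          UpperHalfPlane.qExpansion 1 ⇑CuspForm.discriminant ^ i := by
    rw [← hD]
    simp only [F, ModularForm.qExpansion_mcast,
      ModularForm.qExpansion_mul one_pos one_mem_strictPeriods_SL,
      ModularForm.qExpansion_pow one_pos one_mem_strictPeriods_SL]
  -- the integer power series `P = P₄^α P₆^β (X U)^i = Xⁱ (P₄^α P₆^β Uⁱ)`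
  refine ⟨α, β, F, P₄ ^ α * P₆ ^ β * (PowerSeries.X * U) ^ i, hαβ, hF, ?_, ?_, ?_⟩
  · rw [hF, map_mul, map_mul, map_pow, map_pow, map_pow, map_mul, PowerSeries.map_X, hP₄, hP₆,
      ← hU, CuspForm.coe_discriminant]
  · intro n hn
    rw [mul_pow, show P₄ ^ α * P₆ ^ β * (PowerSeries.X ^ i * U ^ i) =
      PowerSeries.X ^ i * (P₄ ^ α * P₆ ^ β * U ^ i) by ring, PowerSeries.coeff_X_pow_mul',
      if_neg (not_le.mpr hn)]
  · rw [mul_pow, show P₄ ^ α * P₆ ^ β * (PowerSeries.X ^ i * U ^ i) =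
      PowerSeries.X ^ i * (P₄ ^ α * P₆ ^ β * U ^ i) by ring, PowerSeries.coeff_X_pow_mul',
      if_pos le_rfl, Nat.sub_self, PowerSeries.coeff_zero_eq_constantCoeff_apply]
    simp [hP₄1, hP₆1, hU1]

end Summit.Langlands.Langlands.Theorems.HilbertIntegralOverconvergentIsCongruence
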